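import Summits.RiemannHypothesis.RiemannHypothesis.Theorems.IntegerScrewPivotFloorOfRH
import HarnessLib

/-!
# Splittings / screw — B23′: Gundelfinger sharpening of the determinant currency, `RH ⟺ DetNonneg ∧ NoConsecZero`
# (RH-free glue; zero-definition raw form)

Cell rh-split, seat rh-split-screw-neg g3 (card `cards/SPLIT-screw-neg.md` §11, row B23′; scratch
`HOME/rh-split-screw-neg/SplitScrewNegG3.lean` sha16 c2db1903cb50a2d2, its final section; referee g2 content PASS
00:19:19Z «G3.7(ii) IntegerScrewConsecutiveMinors has content pre-file PASS»; lead GO 02:39:16Z after the dedup grep: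
the tree has g2's `rh_iff_detNonneg_and_detNonzero` (CostumeDetectorsScrewIII) and the Schur section of this sketch
(`IntegerScrewPivotFloorOfRH`, p475522, which left B23′ out «deliberately: it carries matrix-valued definitions»);
zero-def raw form by rh-split-typer-1 g3: the seat's `screwBorder₂ n` (two-column border of `screwMatrix n` inside
`screwMatrix (n+2)`) and `screwCorner₂ n` (trailing `2 × 2` corner) are SPELLED OUT as `Matrix.of` lambdas over the
tree's `zetaScrewKernel`, and `DetNonneg` / `NoConsecZero` as `∀ n, 0 ≤ screwDet n` / `∀ n, ¬(screwDet n = 0 ∧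
screwDet (n+1) = 0)`.

Content: g2 typed `RH ⟺ DetNonneg ∧ DetNonzero`.  The zero-pivot rigidity of bordered positive definite matrices (a first
singular level forces the NEXT leading minor to be `≤ 0`: `screwDet_add_two_nonpos_of_zero`, via the two-step bordered
determinant `screwDet_add_two` and the `2 × 2` Schur complement whose `(0,0)` entry is the pivot, `schur₂_zero_zero`)
weakens the second conjunct to «no two CONSECUTIVE leading minors vanish»: `screwDet_pos_of_detNonneg_of_noConsecZero`,
`rh_of_detNonneg_of_noConsecZero`, **`rh_iff_detNonneg_and_noConsecZero`** (RH-EQUIVALENT kernel statement; referee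
label B23′ = RELABELLING / K-costume by construction; class screw×neg UNCHANGED; not a claim about RH).

HONEST LABEL: «SPLITTING SEARCH over kernel-typed RH-EQUIVALENCES; a splitting A ∧ B ⟹ RH is CONDITIONAL
bookkeeping unless A and B are both proved; nothing here bears on the truth of RH.»
-/

noncomputable section

set_option linter.dupNamespace false

namespace Summit.RiemannHypothesis.RiemannHypothesis.Theorems.Splittings.IntegerScrewConsecutiveMinors

open Literature.NumberTheory.LFunctions Matrix Filter Topology
open Summit.RiemannHypothesis.RiemannHypothesis.Theorems.IntegerScrew
open Summit.RiemannHypothesis.RiemannHypothesis.Theorems.IntegerScrew.PivotFloorOfRH (schur_entry_eq_screwPivot)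
open Literature.Analysis.Matrix.SchurConditioning

/-- `screwMatrix (n+2)` in block form: leading block `screwMatrix n`, two-column border, `2 × 2` corner. [folklore] -/
theorem screwMatrix_add_two_submatrix (n : ℕ) :
    (screwMatrix (n + 2)).submatrix (finSumFinEquiv (m := n) (n := 2)) finSumFinEquiv =
      Matrix.fromBlocks (screwMatrix n)
        (Matrix.of fun (i : Fin n) (j : Fin 2) => zetaScrewKernel (Real.log (((i : ℕ) + 2 : ℕ) : ℝ)) (Real.log ((n + (j : ℕ) + 2 : ℕ) : ℝ)))
        (Matrix.of fun (i : Fin n) (j : Fin 2) => zetaScrewKernel (Real.log (((i : ℕ) + 2 : ℕ) : ℝ)) (Real.log ((n + (j : ℕ) + 2 : ℕ) : ℝ)))ᵀ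
        (Matrix.of fun (i j : Fin 2) => zetaScrewKernel (Real.log ((n + (i : ℕ) + 2 : ℕ) : ℝ)) (Real.log ((n + (j : ℕ) + 2 : ℕ) : ℝ))) := by
  ext (i | i) (j | j)
  · simp [screwMatrix_apply, Matrix.fromBlocks]
  · simp [screwMatrix_apply, Matrix.fromBlocks]
  · simp [screwMatrix_apply, Matrix.fromBlocks, zetaScrewKernel_comm]
  · simp [screwMatrix_apply, Matrix.fromBlocks]

/-- Two-step bordered determinant: `det S_{n+2}' = det S_n' · det T`, `T` the `2 × 2` Schur
complement. [folklore] -/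
theorem screwDet_add_two (n : ℕ) [Invertible (screwMatrix n)] :
    screwDet (n + 2) =
      screwDet n * ((Matrix.of fun (i j : Fin 2) => zetaScrewKernel (Real.log ((n + (i : ℕ) + 2 : ℕ) : ℝ)) (Real.log ((n + (j : ℕ) + 2 : ℕ) : ℝ))) -
        (Matrix.of fun (i : Fin n) (j : Fin 2) => zetaScrewKernel (Real.log (((i : ℕ) + 2 : ℕ) : ℝ)) (Real.log ((n + (j : ℕ) + 2 : ℕ) : ℝ)))ᵀ * (screwMatrix n)⁻¹ *
        (Matrix.of fun (i : Fin n) (j : Fin 2) => zetaScrewKernel (Real.log (((i : ℕ) + 2 : ℕ) : ℝ)) (Real.log ((n + (j : ℕ) + 2 : ℕ) : ℝ)))).det := by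
  have h := Matrix.det_submatrix_equiv_self (finSumFinEquiv (m := n) (n := 2)) (screwMatrix (n + 2))
  rw [screwMatrix_add_two_submatrix, Matrix.det_fromBlocks₁₁, Matrix.invOf_eq_nonsing_inv] at h
  rw [screwDet, screwDet, ← h]

/-- Column `0` of the two-column border is the tree's one-column border `screwBorder n`. [folklore] -/
theorem screwBorder₂_col_zero (n : ℕ) (i : Fin n) :
    (Matrix.of fun (i : Fin n) (j : Fin 2) => zetaScrewKernel (Real.log (((i : ℕ) + 2 : ℕ) : ℝ)) (Real.log ((n + (j : ℕ) + 2 : ℕ) : ℝ))) i 0 = screwBorder n i 0 := by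
  simp [screwBorder]

/-- The `(0,0)` entry of the `2 × 2` corner is the tree's `screwCorner n 0 0`. [folklore] -/
theorem screwCorner₂_zero_zero (n : ℕ) :
    (Matrix.of fun (i j : Fin 2) => zetaScrewKernel (Real.log ((n + (i : ℕ) + 2 : ℕ) : ℝ)) (Real.log ((n + (j : ℕ) + 2 : ℕ) : ℝ))) 0 0 = screwCorner n 0 0 := by
  simp [screwCorner]

/-- The `(0,0)` entry of the `2 × 2` Schur complement is the pivot `d_{n+2}`. [folklore] -/
theorem schur₂_zero_zero (n : ℕ) (hn : (screwMatrix n).PosDef) :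
    ((Matrix.of fun (i j : Fin 2) => zetaScrewKernel (Real.log ((n + (i : ℕ) + 2 : ℕ) : ℝ)) (Real.log ((n + (j : ℕ) + 2 : ℕ) : ℝ))) -
        (Matrix.of fun (i : Fin n) (j : Fin 2) => zetaScrewKernel (Real.log (((i : ℕ) + 2 : ℕ) : ℝ)) (Real.log ((n + (j : ℕ) + 2 : ℕ) : ℝ)))ᵀ * (screwMatrix n)⁻¹ *
        (Matrix.of fun (i : Fin n) (j : Fin 2) => zetaScrewKernel (Real.log (((i : ℕ) + 2 : ℕ) : ℝ)) (Real.log ((n + (j : ℕ) + 2 : ℕ) : ℝ)))) 0 0 =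
      screwPivot (n + 2) := by
  rw [← schur_entry_eq_screwPivot n hn, schur]
  simp only [Matrix.sub_apply, Matrix.mul_apply, Matrix.transpose_apply, screwBorder₂_col_zero,
    screwCorner₂_zero_zero]

/-- The `2 × 2` Schur complement is symmetric. [folklore] -/
theorem schur₂_symm (n : ℕ) :
    ((Matrix.of fun (i j : Fin 2) => zetaScrewKernel (Real.log ((n + (i : ℕ) + 2 : ℕ) : ℝ)) (Real.log ((n + (j : ℕ) + 2 : ℕ) : ℝ))) -
        (Matrix.of fun (i : Fin n) (j : Fin 2) => zetaScrewKernel (Real.log (((i : ℕ) + 2 : ℕ) : ℝ)) (Real.log ((n + (j : ℕ) + 2 : ℕ) : ℝ)))ᵀ * (screwMatrix n)⁻¹ *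
        (Matrix.of fun (i : Fin n) (j : Fin 2) => zetaScrewKernel (Real.log (((i : ℕ) + 2 : ℕ) : ℝ)) (Real.log ((n + (j : ℕ) + 2 : ℕ) : ℝ))))ᵀ =
      (Matrix.of fun (i j : Fin 2) => zetaScrewKernel (Real.log ((n + (i : ℕ) + 2 : ℕ) : ℝ)) (Real.log ((n + (j : ℕ) + 2 : ℕ) : ℝ))) -
        (Matrix.of fun (i : Fin n) (j : Fin 2) => zetaScrewKernel (Real.log (((i : ℕ) + 2 : ℕ) : ℝ)) (Real.log ((n + (j : ℕ) + 2 : ℕ) : ℝ)))ᵀ * (screwMatrix n)⁻¹ *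
        (Matrix.of fun (i : Fin n) (j : Fin 2) => zetaScrewKernel (Real.log (((i : ℕ) + 2 : ℕ) : ℝ)) (Real.log ((n + (j : ℕ) + 2 : ℕ) : ℝ))) := by
  have hA : (screwMatrix n)ᵀ = screwMatrix n := by
    have := (screwMatrix_isHermitian n).eq
    rwa [conjTranspose_eq_transpose_of_trivial] at this
  have hC : (Matrix.of fun (i j : Fin 2) => zetaScrewKernel (Real.log ((n + (i : ℕ) + 2 : ℕ) : ℝ)) (Real.log ((n + (j : ℕ) + 2 : ℕ) : ℝ)))ᵀ =
      (Matrix.of fun (i j : Fin 2) => zetaScrewKernel (Real.log ((n + (i : ℕ) + 2 : ℕ) : ℝ)) (Real.log ((n + (j : ℕ) + 2 : ℕ) : ℝ))) := by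
    ext i j
    simp [zetaScrewKernel_comm]
  rw [Matrix.transpose_sub, hC]
  simp [Matrix.transpose_mul, Matrix.transpose_nonsing_inv, hA, Matrix.mul_assoc]

/-- **Gundelfinger step** (RH-free): `screwMatrix n ≻ 0` and `det (screwMatrix (n+1)) = 0` force
`det (screwMatrix (n+2)) ≤ 0` (indeed `= -det(screwMatrix n)·τ²`). [folklore] -/
theorem screwDet_add_two_nonpos_of_zero (n : ℕ) (hn : (screwMatrix n).PosDef)
    (h0 : screwDet (n + 1) = 0) : screwDet (n + 2) ≤ 0 := by
  letI : Invertible (screwMatrix n) := hn.isUnit.invertible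
  set T := (Matrix.of fun (i j : Fin 2) => zetaScrewKernel (Real.log ((n + (i : ℕ) + 2 : ℕ) : ℝ)) (Real.log ((n + (j : ℕ) + 2 : ℕ) : ℝ))) -
        (Matrix.of fun (i : Fin n) (j : Fin 2) => zetaScrewKernel (Real.log (((i : ℕ) + 2 : ℕ) : ℝ)) (Real.log ((n + (j : ℕ) + 2 : ℕ) : ℝ)))ᵀ * (screwMatrix n)⁻¹ *
        (Matrix.of fun (i : Fin n) (j : Fin 2) => zetaScrewKernel (Real.log (((i : ℕ) + 2 : ℕ) : ℝ)) (Real.log ((n + (j : ℕ) + 2 : ℕ) : ℝ))) with hT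
  have hdn : 0 < screwDet n := hn.det_pos
  have h00 : T 0 0 = 0 := by
    rw [hT, schur₂_zero_zero n hn, screwPivot_add_two, h0, zero_div]
  have h10 : T 1 0 = T 0 1 := congrFun (congrFun (schur₂_symm n) 0) 1
  have hdet : T.det = -(T 0 1) ^ 2 := by
    rw [Matrix.det_fin_two, h00, h10]; ring
  have h2 : screwDet (n + 2) = screwDet n * T.det := screwDet_add_two n
  rw [h2, hdet]
  nlinarith [sq_nonneg (T 0 1)]

/-- DetNonneg ∧ NoConsecZero ⟹ every leading minor is positive (induction with the Gundelfinger step). [folklore] -/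
theorem screwDet_pos_of_detNonneg_of_noConsecZero (hA : ∀ n : ℕ, 0 ≤ screwDet n)
    (hB : ∀ n : ℕ, ¬ (screwDet n = 0 ∧ screwDet (n + 1) = 0)) :
    ∀ n, 0 < screwDet n := by
  have key : ∀ n, ∀ k, k ≤ n → 0 < screwDet k := by
    intro n
    induction n with
    | zero =>
        intro k hk
        obtain rfl : k = 0 := by omega
        simp [screwDet]
    | succ n ih =>
        intro k hk
        rcases Nat.lt_or_ge k (n + 1) with hk' | hk'
        · exact ih k (by omega)
        · obtain rfl : k = n + 1 := by omega
          have hpd : (screwMatrix n).PosDef := by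
            refine screwMatrix_posDef_of_screwPivot_pos_le n (fun M hM hMn => ?_) n le_rfl
            obtain ⟨m, rfl⟩ : ∃ m, M = m + 2 := ⟨M - 2, by omega⟩
            rw [screwPivot_add_two]
            exact div_pos (ih (m + 1) (by omega)) (ih m (by omega))
          rcases (hA (n + 1)).lt_or_eq with hpos | hzero
          · exact hpos
          · exfalso
            have hle := screwDet_add_two_nonpos_of_zero n hpd hzero.symm
            exact hB (n + 1) ⟨hzero.symm, le_antisymm hle (hA (n + 2))⟩
  exact fun n => key n n le_rfl

/-- **B23′**: `DetNonneg ∧ NoConsecZero → RH`. [cite: Suzuki2023, Thm 1.2] -/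
theorem rh_of_detNonneg_of_noConsecZero (hA : ∀ n : ℕ, 0 ≤ screwDet n)
    (hB : ∀ n : ℕ, ¬ (screwDet n = 0 ∧ screwDet (n + 1) = 0)) :
    _root_.RiemannHypothesis := by
  have hpos := screwDet_pos_of_detNonneg_of_noConsecZero hA hB
  refine riemannHypothesis_iff_screwPivot_pos.2 fun M hM => ?_
  obtain ⟨m, rfl⟩ : ∃ m, M = m + 2 := ⟨M - 2, by omega⟩
  rw [screwPivot_add_two]
  exact div_pos (hpos (m + 1)) (hpos m)

/-- **B23′ as an RH-equivalence**: `RH ⟺ DetNonneg ∧ NoConsecZero`. [cite: Suzuki2023, Thm 1.2] -/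
theorem rh_iff_detNonneg_and_noConsecZero :
    _root_.RiemannHypothesis ↔
      (∀ n : ℕ, 0 ≤ screwDet n) ∧ (∀ n : ℕ, ¬ (screwDet n = 0 ∧ screwDet (n + 1) = 0)) := by
  constructor
  · intro hRH
    have hpos : ∀ n, 0 < screwDet n := fun n =>
      (screwMatrix_posDef_of_riemannHypothesis hRH n).det_pos
    exact ⟨fun n => (hpos n).le, fun n h => (hpos n).ne' h.1⟩
  · rintro ⟨hA, hB⟩
    exact rh_of_detNonneg_of_noConsecZero hA hB

end Summit.RiemannHypothesis.RiemannHypothesis.Theorems.Splittings.IntegerScrewConsecutiveMinors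

end
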